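import Summits.BirchSwinnertonDyer.BirchSwinnertonDyer.Theorems.PrintCf2RubinValueTwoLinePinThetaLineComposition
import Summits.BirchSwinnertonDyer.BirchSwinnertonDyer.Theorems.PrintCf2RubinValueTwoLinePinThetaLineTwist
import Summits.BirchSwinnertonDyer.BirchSwinnertonDyer.Theorems.PrintCf2RubinValueTwoLinePinXRegularInnerOfLocSurj
import Summits.BirchSwinnertonDyer.BirchSwinnertonDyer.Theorems.PrintCf2SplitBadTwoLocSurjCharModuleThetaOne
import HarnessLib

/-!
# M-LINE-PIN, stub (T) `MLinePin.stub_thetaLine` ASSEMBLED: BOTH characters of the `v`-line (θ = 1 and θ = χ_v) from the θ = 1-type inputs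
# (Q_T) ⊗ℚ-form ∧ (A_T) trivial-branch restriction — quantified over every TRIVIAL framed character — and ty2's Müller fact; (R) DISCHARGED (§3)

Cell `bsd-print-cf2`, WIDTH seat `bsd-line-cf2-p1-w5` g8 (prover-bsd-line-cf2-p1-w5-g8-0). Helper, Theses-free, `--supports` the M-LINE-PIN item.
HONEST FRAMING: `thetaLine_of_inputs` has EXACTLY the binders of `MLinePin.stub_thetaLine` (`Cruxes/MainConjClauseAtSplitTwoQuad/Lines/m_line_pin.lean`
l. 242–265: DA7 frame, `θ² = 1`, `θ|_{ker κ₁} = 1`, `θ_K`, `S`, `G₂`, `D`) followed by the named fact (M₀) and three DISPLAYED inputs, each quantified over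
every framed `θ₀` with `θ₀ σ = 1`, its Hecke avatars and all Katz measures of its branch: (R) inner `T₂`-regularity, (Q_T) the ⊗ℚ-form, (A_T) the
trivial-branch restriction. The θ = 1-type character goes through `…ThetaLineComposition.thetaLine_of_inputs_of_apply_eq_one` (p708027); the SECOND
character of the line (`θ ≠ 1`, `θ|_{ker κ₁} = 1`) is TWISTED to `θ ⊗ det θ` by `…ThetaLineTwist.clause_of_clause_twist_det` (p708351) — so (T) needs
NO input beyond the θ = 1-type ones. Glue proved here: `θ|_{ker κ₁} = 1` ⟹ `θ` through the pair and unramified away from `2` (inertia off `v` lies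
in `ker κ₁`, -w4 g14's `KummerUDict.exists_mem_inertia_apply_ne_one_of_not_isUnramifiedAt`), and the exact tame set of such `θ` is EMPTY. §3
`thetaLine_of_powForm_of_restriction` then DISCHARGES (R) for every trivial `θ₀` — LEAD cf2-p1 g14's one-pair socket
`XRegInner.xRegularInner_char_of_locSurj₁` (p706693) fed by -w7 g6's unconditional (LS↑₁) on the `v`-line
(`KummerProNull.locSurj_kerSubgroup_charModule_of_unitChar_eq_one_of_isUnramifiedOutside_v`), shows `S = ∅` and that the Hecke avatar of a
trivial `θ₀` IS `1` (`heckeChar_eq_one_of_isHeckeCharOf`) — leaving (T) ⟸ (M₀) ∧ (Q_T) ∧ (A_T) with (Q_T), (A_T) DISPLAYED FOR THE TRIVIAL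
BRANCH ITSELF (`IsKatzMeasure₂ ι v v̄ ∅ κ₁ κ₂ γ₁⁻¹ γ₂⁻¹ 1 Ω δ Ω_p G`, `IsNuPseudoBranch ι v κ₁ γ₁⁻¹ 1 Ω′ Ω_p′ G₁`). (Q_T) is
RESEARCH (the two-variable [MC] ⊗ ℚ for the trivial branch), (A_T) is analytic (ty2 lineage), (M₀) is print — none is proved here; no summit statement
is proved by this seat; BSD is not proved by any of this. THEOREMS ONLY (no definition, no named fact, no `sorry`). beyond-print theorem: no.

References: [Mueller2020MCSplitTwo] Thm. 1.1, Def. 2.5; [deShalit1987] II.4.12, II.4.17; [GreenbergLNM1716] §3–4; [GreenbergVatsal2000] §2 Prop. 2.1;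
[Washington1997] §13.1–13.2.
-/

noncomputable section

open scoped Classical

-- the summit namespace `Summit.BirchSwinnertonDyer.BirchSwinnertonDyer` repeats the problem name by design (D-0017)
set_option linter.dupNamespace false
set_option autoImplicit false

open NumberField IsDedekindDomain Field WeierstrassCurve Literature.NumberTheory.GaloisRepresentations
  Literature.NumberTheory.EllipticCurves Literature.NumberTheory.EllipticCurves.GreenbergSelmer Literature.NumberTheory.EllipticCurves.GreenbergVatsal2000
  Literature.NumberTheory.EllipticCurves.KellerYin2024 Literature.NumberTheory.EllipticCurves.DeShalit1987
  Literature.NumberTheory.EllipticCurves.Muller2020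
  Summit.BirchSwinnertonDyer.BirchSwinnertonDyer.Theorems.PrintCf2

namespace Summit.BirchSwinnertonDyer.BirchSwinnertonDyer.Theorems.PrintCf2.LinePinThetaOne

/-! ## §1. Glue: a framed character trivial on `ker κ₁` factors through the pair and is unramified off `v` -/

section Glue

variable {K : Type} [Field K] [NumberField K] {p : ℕ} [Fact p.Prime]

omit [NumberField K] in
/-- `θ|_{ker κ₁} = 1` ⟹ `θ` factors through the `ℤ_p²`-tower. [cite: deShalit1987, II.4.17 (54)] -/
theorem factorsThroughPair_of_kerTrivial {A : Type*} [CommRing A] [TopologicalSpace A] {κ₁ : ZpExtension K p} (κ₂ : ZpExtension K p)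
    {θ : FramedGaloisRep K A 1} (hθκ : ∀ σ : absoluteGaloisGroup K, σ ∈ κ₁.kerSubgroup → θ σ = 1) : FactorsThroughPair κ₁ κ₂ θ :=
  fun σ h₁ _ ↦ hθκ σ (ZpExtension.mem_kerSubgroup.mpr h₁)

/-- `θ|_{ker κ₁} = 1` with `κ₁` unramified outside `v` ⟹ `θ` is unramified at every `w ≠ v` (the chosen inertia group at `w` lies in `ker κ₁`; transport to
every prime above `w` by -w4 g14's `exists_mem_inertia_apply_ne_one_of_not_isUnramifiedAt`). [cite: NeukirchANT1999, Ch. I §9 (9.4)] -/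
theorem isUnramifiedAt_of_kerTrivial {A : Type*} [CommRing A] [TopologicalSpace A] {κ₁ : ZpExtension K p} {v : HeightOneSpectrum (𝓞 K)}
    (hκ₁ : κ₁.IsUnramifiedOutside v) {θ : FramedGaloisRep K A 1} (hθκ : ∀ σ : absoluteGaloisGroup K, σ ∈ κ₁.kerSubgroup → θ σ = 1)
    {w : HeightOneSpectrum (𝓞 K)} (hw : w ≠ v) : θ.IsUnramifiedAt w := by
  by_contra h
  obtain ⟨τ, hτ, hne⟩ := KummerUDict.exists_mem_inertia_apply_ne_one_of_not_isUnramifiedAt θ h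
  exact hne (hθκ τ (hκ₁ w hw hτ))

end Glue

/-! ## §2. `stub_thetaLine` from the θ = 1-type inputs -/

section Assembly

/-- **(T) `stub_thetaLine` FROM ITS DISPLAYED INPUTS — both characters of the line.** Binders = `MLinePin.stub_thetaLine` VERBATIM; then (M₀) ty2's named
fact `Muller2020.thm13_trivialChar_exists_nuPseudoBranch_charIdeal_eq` and, for EVERY framed `θ₀` with `θ₀ σ = 1`, every Hecke avatar `θ_K⁰` and every
Katz measure `G` of the `θ_K⁰⁻¹`-branch (same frame, same `S`): (R) inner `T₂`-regularity of the dual data of `A_{θ₀}`, (Q_T) the ⊗ℚ-form at `G`, (A_T)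
`G(T₁,0) ≠ 0 ∧ (G(T₁,0)) = (G₁)` for Müller's pseudo-branch `G₁`. CONCLUSION: the DA7 clause for `θ` at `G₂`. The θ = 1-type character is p708027; the
second character of the line is twisted to `θ ⊗ det θ` (p708351), whose Hecke avatar is `θ_K θ_K` and whose exact tame set is again `S = ∅`.
[cite: Mueller2020MCSplitTwo, Thm. 1.1, Def. 2.5] [cite: deShalit1987, II.4.12, II.4.17 (52)–(54)] [cite: GreenbergLNM1716, §3–4] -/
theorem thetaLine_of_inputs (hM₀ : Muller2020.thm13_trivialChar_exists_nuPseudoBranch_charIdeal_eq) :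
    ∀ (K : Type) [Field K] [NumberField K], IsImaginaryQuadratic K → ¬ 2 ∣ NumberField.classNumber K →
      NumberField.discr K = -7 →
    ∀ (ι : PadicAlgCl 2 ≃+* ℂ) (v vbar : HeightOneSpectrum (𝓞 K)),
      ((2 : ℕ) : 𝓞 K) ∈ v.asIdeal → ((2 : ℕ) : 𝓞 K) ∈ vbar.asIdeal → vbar ≠ v →
      (∀ (w : InfinitePlace K) (k : 𝓞 K), k ∈ v.asIdeal ↔ ‖ι.symm (w.embedding (k : K))‖ < 1) →
    ∀ (Ω δ : ℂ) (Ωp : (unrIntegers 2)ˣ), Ω ≠ 0 →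
      (δ ^ 2 = (NumberField.discr K : ℂ) ∨ δ ^ 2 = -(NumberField.discr K : ℂ)) →
    ∀ (κ₁ κ₂ : ZpExtension K 2) (γ₁ γ₂ : absoluteGaloisGroup K),
      ZpExtension.IsTopGeneratorPair κ₁ κ₂ γ₁ γ₂ → κ₂.IsUnramifiedOutside vbar →
      κ₁.IsUnramifiedOutside v → γ₁ ∈ GreenbergSelmer.inertia v → γ₂ ∈ GreenbergSelmer.inertia vbar →
    ∀ (θ : FramedGaloisRep K (padicCoeffIntegers (∅ : Set (PadicAlgCl 2))) 1),
      (∀ σ : absoluteGaloisGroup K, θ σ ^ 2 = 1) → (∀ σ ∈ κ₁.kerSubgroup, θ σ = 1) →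
    ∀ (θK : HeckeCharacter K), KellerYin2024.IsHeckeCharOf ι θ θK →
    ∀ (S : Finset (HeightOneSpectrum (𝓞 K))), v ∉ S → vbar ∉ S →
      (∀ w ∈ S, ¬ θK.IsUnramifiedAt w) →
      (∀ w : HeightOneSpectrum (𝓞 K), w ∉ S → w ≠ v → w ≠ vbar → θK.IsUnramifiedAt w) →
    ∀ G₂ : PowerSeries (PowerSeries (PadicComplexInt 2)),
      IsKatzMeasure₂ ι v vbar S κ₁ κ₂ γ₁⁻¹ γ₂⁻¹ θK⁻¹ Ω δ ((Ωp : unrIntegers 2) : ℂ_[2]) G₂ →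
    -- (R) inner `T₂`-regularity, for every trivial framed character
    (∀ θ₀ : FramedGaloisRep K (padicCoeffIntegers (∅ : Set (PadicAlgCl 2))) 1, (∀ σ : absoluteGaloisGroup K, θ₀ σ = 1) →
      ∀ D : DualData₂ κ₁ κ₂ (KellerYin2024.charModule (∅ : Set (PadicAlgCl 2)) θ₀) vbar γ₁ γ₂,
        Module.Finite (IwasawaAlgebra₂ 2) D.X → Module.IsTorsion (IwasawaAlgebra₂ 2) D.X →
        ∀ x : D.X, (PowerSeries.C (PowerSeries.X : IwasawaAlgebra 2) : IwasawaAlgebra₂ 2) • x = 0 → x = 0) →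
    -- (Q_T) the ⊗ℚ-form, for every trivial framed character, Hecke avatar and Katz measure of its branch
    (∀ θ₀ : FramedGaloisRep K (padicCoeffIntegers (∅ : Set (PadicAlgCl 2))) 1, (∀ σ : absoluteGaloisGroup K, θ₀ σ = 1) →
      ∀ θK₀ : HeckeCharacter K, KellerYin2024.IsHeckeCharOf ι θ₀ θK₀ →
      ∀ G : PowerSeries (PowerSeries (PadicComplexInt 2)), IsKatzMeasure₂ ι v vbar S κ₁ κ₂ γ₁⁻¹ γ₂⁻¹ θK₀⁻¹ Ω δ ((Ωp : unrIntegers 2) : ℂ_[2]) G →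
      ∀ D : DualData₂ κ₁ κ₂ (KellerYin2024.charModule (∅ : Set (PadicAlgCl 2)) θ₀) vbar γ₁ γ₂,
        Module.Finite (IwasawaAlgebra₂ 2) D.X → Module.IsTorsion (IwasawaAlgebra₂ 2) D.X →
        ∀ F : IwasawaAlgebra₂ 2, Module.charIdeal (IwasawaAlgebra₂ 2) D.X = Ideal.span {F} →
        ∀ (J : ℤ_[2] →+* PadicComplexInt 2), (∀ x : ℤ_[2], ((J x : PadicComplexInt 2) : ℂ_[2]) = ((x : ℚ_[2]) : ℂ_[2])) →
        ∃ a b : ℕ, Ideal.span ({((2 : ℕ) : PowerSeries (PowerSeries (PadicComplexInt 2))) ^ a *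
            PowerSeries.map (PowerSeries.map J) F} : Set (PowerSeries (PowerSeries (PadicComplexInt 2)))) =
          Ideal.span {((2 : ℕ) : PowerSeries (PowerSeries (PadicComplexInt 2))) ^ b * G}) →
    -- (A_T) the trivial-branch restriction, for every trivial framed character, Hecke avatar and Katz measure of its branch
    (∀ θ₀ : FramedGaloisRep K (padicCoeffIntegers (∅ : Set (PadicAlgCl 2))) 1, (∀ σ : absoluteGaloisGroup K, θ₀ σ = 1) →
      ∀ θK₀ : HeckeCharacter K, KellerYin2024.IsHeckeCharOf ι θ₀ θK₀ →
      ∀ G : PowerSeries (PowerSeries (PadicComplexInt 2)), IsKatzMeasure₂ ι v vbar S κ₁ κ₂ γ₁⁻¹ γ₂⁻¹ θK₀⁻¹ Ω δ ((Ωp : unrIntegers 2) : ℂ_[2]) G →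
      ∀ (Ω' : ℂ) (Ωp' : (unrIntegers 2)ˣ) (G₁ : PowerSeries (PadicComplexInt 2)), Ω' ≠ 0 →
        IsNuPseudoBranch ι v κ₁ γ₁⁻¹ θK₀⁻¹ Ω' ((Ωp' : unrIntegers 2) : ℂ_[2]) G₁ →
        (∀ D₁ : DatumDualData κ₁ γ₁ (KellerYin2024.charModule (∅ : Set (PadicAlgCl 2)) θ₀)
            (Castella2018.AcSelmer.bdpData (KellerYin2024.charModule (∅ : Set (PadicAlgCl 2)) θ₀) 2 vbar) ∅,
          Module.Finite (IwasawaAlgebra 2) D₁.X ∧ Module.IsTorsion (IwasawaAlgebra 2) D₁.X ∧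
          ∀ (J : ℤ_[2] →+* PadicComplexInt 2), (∀ x : ℤ_[2], ((J x : PadicComplexInt 2) : ℂ_[2]) = ((x : ℚ_[2]) : ℂ_[2])) →
            (Module.charIdeal (IwasawaAlgebra 2) D₁.X).map (PowerSeries.map J) = Ideal.span {G₁}) →
        PowerSeries.map (PowerSeries.constantCoeff (R := PadicComplexInt 2)) G ≠ 0 ∧
        Ideal.span ({PowerSeries.map (PowerSeries.constantCoeff (R := PadicComplexInt 2)) G} : Set (PowerSeries (PadicComplexInt 2))) =
          Ideal.span {G₁}) →
    ∀ D : DualData₂ κ₁ κ₂ (KellerYin2024.charModule (∅ : Set (PadicAlgCl 2)) θ) vbar γ₁ γ₂,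
      Module.Finite (IwasawaAlgebra₂ 2) D.X ∧ Module.IsTorsion (IwasawaAlgebra₂ 2) D.X ∧
      ∀ (J : ℤ_[2] →+* PadicComplexInt 2),
        (∀ x : ℤ_[2], ((J x : PadicComplexInt 2) : ℂ_[2]) = ((x : ℚ_[2]) : ℂ_[2])) →
        (Module.charIdeal (IwasawaAlgebra₂ 2) D.X).map (PowerSeries.map (PowerSeries.map J)) = Ideal.span {G₂} := by
  intro K _ _ hK h2K hdK ι v vbar hv hvbar hne hι Ω δ Ωp hΩ hδ κ₁ κ₂ γ₁ γ₂ hpair hκ₂ hκ₁ hγ₁ hγ₂ θ hθ2 hθκ θK hθK S hvS hvbarS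
    hSram hSunr G₂ hG₂ hR hQ hA D
  by_cases hθ1 : ∀ σ : absoluteGaloisGroup K, θ σ = 1
  · -- the θ = 1-type character
    exact thetaLine_of_inputs_of_apply_eq_one hM₀ K hK h2K hdK ι v vbar hv hvbar hne hι Ω δ Ωp hΩ hδ κ₁ κ₂ γ₁ γ₂ hpair hκ₂ hκ₁ hγ₁ hγ₂
      θ hθ1 θK hθK S hvS hvbarS hSram hSunr G₂ hG₂ (hR θ hθ1) (hQ θ hθ1 θK hθK G₂ hG₂) (hA θ hθ1 θK hθK G₂ hG₂) D
  · -- the second character of the line: twist to `θ ⊗ det θ`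
    have hθpair : FactorsThroughPair κ₁ κ₂ θ := factorsThroughPair_of_kerTrivial κ₂ hθκ
    have hθunr : ∀ w : HeightOneSpectrum (𝓞 K), ((2 : ℕ) : 𝓞 K) ∉ w.asIdeal → θ.IsUnramifiedAt w :=
      fun w hw ↦ isUnramifiedAt_of_kerTrivial hκ₁ hθκ (fun h ↦ hw (h ▸ hv))
    -- the exact tame set of `θ` is empty
    have hS : ∀ w : HeightOneSpectrum (𝓞 K), w ∉ S := by
      intro w hw
      have hwv : w ≠ v := fun h ↦ hvS (h ▸ hw)
      exact hSram w hw (hθK w (isUnramifiedAt_of_kerTrivial hκ₁ hθκ hwv)).1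
    have hθ₀1 : ∀ σ : absoluteGaloisGroup K, FramedRep.twist θ (FramedRep.det θ) σ = 1 := fun σ ↦ twist_det_apply_eq_one θ (hθ2 σ)
    have hθK₀ := isHeckeCharOf_twist_det (ι := ι) θ hθ2 hθK
    have hSram₀ : ∀ w ∈ S, ¬ (θK * θK).IsUnramifiedAt w := fun w hw ↦ (hS w hw).elim
    have hSunr₀ : ∀ w : HeightOneSpectrum (𝓞 K), w ∉ S → w ≠ v → w ≠ vbar → (θK * θK).IsUnramifiedAt w :=
      fun w hw hwv hwvbar ↦ (hSunr w hw hwv hwvbar).mul' (hSunr w hw hwv hwvbar)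
    refine clause_of_clause_twist_det θ hθ2 hθpair hθunr hθK hG₂ (fun G₀ hG₀ ↦ ?_) D
    exact thetaLine_of_inputs_of_apply_eq_one hM₀ K hK h2K hdK ι v vbar hv hvbar hne hι Ω δ Ωp hΩ hδ κ₁ κ₂ γ₁ γ₂ hpair hκ₂ hκ₁ hγ₁ hγ₂
      _ hθ₀1 (θK * θK) hθK₀ S hvS hvbarS hSram₀ hSunr₀ G₀ hG₀ (hR _ hθ₀1) (hQ _ hθ₀1 _ hθK₀ G₀ hG₀) (hA _ hθ₀1 _ hθK₀ G₀ hG₀)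

end Assembly

/-! ## §3. (R) discharged, `S = ∅` and `θ_K⁰ = 1` resolved: (T) from (M₀), (Q_T), (A_T) displayed for the trivial branch itself -/

section Discharged

variable {K : Type} [Field K] [NumberField K]

/-- **The Hecke avatar of a TRIVIAL framed character is the trivial Hecke character**: `θ₀ ⊗ det θ₀ = θ₀` has avatar `θ_K⁰ θ_K⁰`
(`isHeckeCharOf_twist_det`), so `θ_K⁰ θ_K⁰ = θ_K⁰` by uniqueness of the avatar. [cite: CastellaGrossiLeeSkinner2022, Thm. 2.1.2 (θ_K)] [cite: TateThesis1967, Lemma 3.2.1] -/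
theorem heckeChar_eq_one_of_isHeckeCharOf (ι : PadicAlgCl 2 ≃+* ℂ) {θ₀ : FramedGaloisRep K (padicCoeffIntegers (∅ : Set (PadicAlgCl 2))) 1}
    (hθ₀ : ∀ σ : absoluteGaloisGroup K, θ₀ σ = 1) {θK₀ : HeckeCharacter K} (hθK₀ : KellerYin2024.IsHeckeCharOf ι θ₀ θK₀) : θK₀ = 1 := by
  have hθ2 : ∀ σ : absoluteGaloisGroup K, θ₀ σ ^ 2 = 1 := fun σ ↦ by rw [hθ₀ σ, one_pow]
  have hdet : FramedRep.det θ₀ = 1 := by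
    refine ContinuousMonoidHom.ext fun σ ↦ ?_
    rw [FramedRep.det_apply, hθ₀ σ, map_one, ContinuousMonoidHom.coe_one, Pi.one_apply]
  have h := isHeckeCharOf_twist_det (ι := ι) θ₀ hθ2 hθK₀
  rw [hdet, FramedRep.twist_one] at h
  exact mul_eq_left.mp (heckeChar_eq_of_isHeckeCharOf ι hθ2 h hθK₀)

/-- **(T) `stub_thetaLine` FROM (M₀), (Q_T) AND (A_T) ALONE, the inputs displayed for the TRIVIAL BRANCH ITSELF (`S = ∅`, `λ = 1`).** Binders =
`MLinePin.stub_thetaLine` VERBATIM; then: (M₀) ty2's named fact; (Q_T) the ⊗ℚ-form for every trivial framed `θ₀` and every `G` with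
`IsKatzMeasure₂ ι v v̄ ∅ κ₁ κ₂ γ₁⁻¹ γ₂⁻¹ 1 Ω δ Ω_p G`; (A_T) for the same `θ₀`, `G`: against ANY pseudo-branch `G₁` (`IsNuPseudoBranch ι v κ₁ γ₁⁻¹ 1 Ω′ Ω_p′
G₁`) generating the characteristic ideals of the line's dual data, `G(T₁,0) ≠ 0 ∧ (G(T₁,0)) = (G₁)`. Reductions proved here: the exact tame set `S` of
the stub is EMPTY (`θ|_{ker κ₁} = 1` ⟹ `θ` unramified off `v` ⟹ so is `θ_K`), the avatar `θ_K⁰` of a trivial `θ₀` IS `1`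
(`heckeChar_eq_one_of_isHeckeCharOf`), and (R) for trivial `θ₀` is LEAD cf2-p1 g14's one-pair socket `XRegInner.xRegularInner_char_of_locSurj₁` (p706693)
fed by -w7 g6's unconditional (LS↑₁) `KummerProNull.locSurj_kerSubgroup_charModule_of_unitChar_eq_one_of_isUnramifiedOutside_v` (`unitChar θ₀ = 1`
by `unitChar_pow_eq_one` at `n = 1`). [cite: GreenbergVatsal2000, §2 Prop. 2.1] [cite: Mueller2020MCSplitTwo, Thm. 1.1, Def. 2.5] [cite: deShalit1987, II.4.12, II.4.17] -/
theorem thetaLine_of_powForm_of_restriction (hM₀ : Muller2020.thm13_trivialChar_exists_nuPseudoBranch_charIdeal_eq) :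
    ∀ (K : Type) [Field K] [NumberField K], IsImaginaryQuadratic K → ¬ 2 ∣ NumberField.classNumber K →
      NumberField.discr K = -7 →
    ∀ (ι : PadicAlgCl 2 ≃+* ℂ) (v vbar : HeightOneSpectrum (𝓞 K)),
      ((2 : ℕ) : 𝓞 K) ∈ v.asIdeal → ((2 : ℕ) : 𝓞 K) ∈ vbar.asIdeal → vbar ≠ v →
      (∀ (w : InfinitePlace K) (k : 𝓞 K), k ∈ v.asIdeal ↔ ‖ι.symm (w.embedding (k : K))‖ < 1) →
    ∀ (Ω δ : ℂ) (Ωp : (unrIntegers 2)ˣ), Ω ≠ 0 →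
      (δ ^ 2 = (NumberField.discr K : ℂ) ∨ δ ^ 2 = -(NumberField.discr K : ℂ)) →
    ∀ (κ₁ κ₂ : ZpExtension K 2) (γ₁ γ₂ : absoluteGaloisGroup K),
      ZpExtension.IsTopGeneratorPair κ₁ κ₂ γ₁ γ₂ → κ₂.IsUnramifiedOutside vbar →
      κ₁.IsUnramifiedOutside v → γ₁ ∈ GreenbergSelmer.inertia v → γ₂ ∈ GreenbergSelmer.inertia vbar →
    ∀ (θ : FramedGaloisRep K (padicCoeffIntegers (∅ : Set (PadicAlgCl 2))) 1),
      (∀ σ : absoluteGaloisGroup K, θ σ ^ 2 = 1) → (∀ σ ∈ κ₁.kerSubgroup, θ σ = 1) →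
    ∀ (θK : HeckeCharacter K), KellerYin2024.IsHeckeCharOf ι θ θK →
    ∀ (S : Finset (HeightOneSpectrum (𝓞 K))), v ∉ S → vbar ∉ S →
      (∀ w ∈ S, ¬ θK.IsUnramifiedAt w) →
      (∀ w : HeightOneSpectrum (𝓞 K), w ∉ S → w ≠ v → w ≠ vbar → θK.IsUnramifiedAt w) →
    ∀ G₂ : PowerSeries (PowerSeries (PadicComplexInt 2)),
      IsKatzMeasure₂ ι v vbar S κ₁ κ₂ γ₁⁻¹ γ₂⁻¹ θK⁻¹ Ω δ ((Ωp : unrIntegers 2) : ℂ_[2]) G₂ →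
    -- (Q_T) the ⊗ℚ-form of the TRIVIAL branch (`S = ∅`, `λ = 1`): every trivial framed character, every Katz measure
    (∀ θ₀ : FramedGaloisRep K (padicCoeffIntegers (∅ : Set (PadicAlgCl 2))) 1, (∀ σ : absoluteGaloisGroup K, θ₀ σ = 1) →
      ∀ G : PowerSeries (PowerSeries (PadicComplexInt 2)),
        IsKatzMeasure₂ ι v vbar ∅ κ₁ κ₂ γ₁⁻¹ γ₂⁻¹ (1 : HeckeCharacter K) Ω δ ((Ωp : unrIntegers 2) : ℂ_[2]) G →
      ∀ D : DualData₂ κ₁ κ₂ (KellerYin2024.charModule (∅ : Set (PadicAlgCl 2)) θ₀) vbar γ₁ γ₂,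
        Module.Finite (IwasawaAlgebra₂ 2) D.X → Module.IsTorsion (IwasawaAlgebra₂ 2) D.X →
        ∀ F : IwasawaAlgebra₂ 2, Module.charIdeal (IwasawaAlgebra₂ 2) D.X = Ideal.span {F} →
        ∀ (J : ℤ_[2] →+* PadicComplexInt 2), (∀ x : ℤ_[2], ((J x : PadicComplexInt 2) : ℂ_[2]) = ((x : ℚ_[2]) : ℂ_[2])) →
        ∃ a b : ℕ, Ideal.span ({((2 : ℕ) : PowerSeries (PowerSeries (PadicComplexInt 2))) ^ a *
            PowerSeries.map (PowerSeries.map J) F} : Set (PowerSeries (PowerSeries (PadicComplexInt 2)))) =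
          Ideal.span {((2 : ℕ) : PowerSeries (PowerSeries (PadicComplexInt 2))) ^ b * G}) →
    -- (A_T) the restriction of the TRIVIAL branch to the `v`-line against Müller's pseudo-branch (`S = ∅`, `λ = 1`)
    (∀ θ₀ : FramedGaloisRep K (padicCoeffIntegers (∅ : Set (PadicAlgCl 2))) 1, (∀ σ : absoluteGaloisGroup K, θ₀ σ = 1) →
      ∀ G : PowerSeries (PowerSeries (PadicComplexInt 2)),
        IsKatzMeasure₂ ι v vbar ∅ κ₁ κ₂ γ₁⁻¹ γ₂⁻¹ (1 : HeckeCharacter K) Ω δ ((Ωp : unrIntegers 2) : ℂ_[2]) G →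
      ∀ (Ω' : ℂ) (Ωp' : (unrIntegers 2)ˣ) (G₁ : PowerSeries (PadicComplexInt 2)), Ω' ≠ 0 →
        IsNuPseudoBranch ι v κ₁ γ₁⁻¹ (1 : HeckeCharacter K) Ω' ((Ωp' : unrIntegers 2) : ℂ_[2]) G₁ →
        (∀ D₁ : DatumDualData κ₁ γ₁ (KellerYin2024.charModule (∅ : Set (PadicAlgCl 2)) θ₀)
            (Castella2018.AcSelmer.bdpData (KellerYin2024.charModule (∅ : Set (PadicAlgCl 2)) θ₀) 2 vbar) ∅,
          Module.Finite (IwasawaAlgebra 2) D₁.X ∧ Module.IsTorsion (IwasawaAlgebra 2) D₁.X ∧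
          ∀ (J : ℤ_[2] →+* PadicComplexInt 2), (∀ x : ℤ_[2], ((J x : PadicComplexInt 2) : ℂ_[2]) = ((x : ℚ_[2]) : ℂ_[2])) →
            (Module.charIdeal (IwasawaAlgebra 2) D₁.X).map (PowerSeries.map J) = Ideal.span {G₁}) →
        PowerSeries.map (PowerSeries.constantCoeff (R := PadicComplexInt 2)) G ≠ 0 ∧
        Ideal.span ({PowerSeries.map (PowerSeries.constantCoeff (R := PadicComplexInt 2)) G} : Set (PowerSeries (PadicComplexInt 2))) =
          Ideal.span {G₁}) →
    ∀ D : DualData₂ κ₁ κ₂ (KellerYin2024.charModule (∅ : Set (PadicAlgCl 2)) θ) vbar γ₁ γ₂,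
      Module.Finite (IwasawaAlgebra₂ 2) D.X ∧ Module.IsTorsion (IwasawaAlgebra₂ 2) D.X ∧
      ∀ (J : ℤ_[2] →+* PadicComplexInt 2),
        (∀ x : ℤ_[2], ((J x : PadicComplexInt 2) : ℂ_[2]) = ((x : ℚ_[2]) : ℂ_[2])) →
        (Module.charIdeal (IwasawaAlgebra₂ 2) D.X).map (PowerSeries.map (PowerSeries.map J)) = Ideal.span {G₂} := by
  intro K _ _ hK h2K hdK ι v vbar hv hvbar hne hι Ω δ Ωp hΩ hδ κ₁ κ₂ γ₁ γ₂ hpair hκ₂ hκ₁ hγ₁ hγ₂ θ hθ2 hθκ θK hθK S hvS hvbarS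
    hSram hSunr G₂ hG₂ hQ hA
  -- the exact tame set is empty
  have hS0 : S = ∅ := Finset.eq_empty_of_forall_notMem fun w hw ↦
    hSram w hw (hθK w (isUnramifiedAt_of_kerTrivial hκ₁ hθκ (fun h ↦ hvS (h ▸ hw)))).1
  subst hS0
  refine thetaLine_of_inputs hM₀ K hK h2K hdK ι v vbar hv hvbar hne hι Ω δ Ωp hΩ hδ κ₁ κ₂ γ₁ γ₂ hpair hκ₂ hκ₁ hγ₁ hγ₂ θ hθ2 hθκ θK hθK ∅
    hvS hvbarS hSram hSunr G₂ hG₂ (fun θ₀ hθ₀ D _ _ ↦ ?_) (fun θ₀ hθ₀ θK₀ hθK₀ G hG ↦ ?_)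
    (fun θ₀ hθ₀ θK₀ hθK₀ G hG Ω' Ωp' G₁ hΩ' hG₁ ↦ ?_)
  · -- (R) for the trivial character `θ₀`
    have h1 : ∀ σ : absoluteGaloisGroup K, θ₀ σ ^ 1 = 1 := fun σ ↦ by rw [pow_one]; exact hθ₀ σ
    have hu : ∀ σ : absoluteGaloisGroup K, unitChar θ₀ σ = 1 := fun σ ↦ by
      simpa only [pow_one] using unitChar_pow_eq_one θ₀ h1 σ
    exact XRegInner.xRegularInner_char_of_locSurj₁ K hK h2K v vbar hv hvbar hne κ₁ κ₂ γ₁ γ₂ hpair θ₀ 1 one_pos h1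
      (KummerProNull.locSurj_kerSubgroup_charModule_of_unitChar_eq_one_of_isUnramifiedOutside_v hK hv hvbar hne κ₁ hκ₁ θ₀ hu) D
  · -- (Q_T): the avatar of `θ₀` is `1`
    have h1 := heckeChar_eq_one_of_isHeckeCharOf ι hθ₀ hθK₀
    subst h1
    rw [inv_one] at hG
    exact hQ θ₀ hθ₀ G hG
  · -- (A_T): the avatar of `θ₀` is `1`
    have h1 := heckeChar_eq_one_of_isHeckeCharOf ι hθ₀ hθK₀
    subst h1
    rw [inv_one] at hG hG₁
    exact hA θ₀ hθ₀ G hG Ω' Ωp' G₁ hΩ' hG₁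

end Discharged

end Summit.BirchSwinnertonDyer.BirchSwinnertonDyer.Theorems.PrintCf2.LinePinThetaOne

end
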